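import Summits.ABC.ABC.Theses.DefiniteXi
import HarnessLib

/-!
# Stub-ideation k2, generation 18 (FAMILY 2 — RESHAPE) — `stub_primeToSixDegreeBound` (P6)
# crux `DefiniteXi.SteinbergCore` (stmt-ABC-15024), line `p6_tamagawa_split`

Scratch (statements only; elaboration sanity).  Two Family-2 probes, both DOCUMENTARY (they reduce to
recorded cells; see STUB-IDEAS-stub_primeToSixDegreeBound-2.md gen 18):
(S) weaken-and-bootstrap along the credited prime set `S ⊇ {2,3}` — `StubS S`;
(A) strengthen-to-simplify to all curves `E/ℚ` — `StubAll` (the prime-to-6 degree conjecture).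
-/

noncomputable section

set_option linter.dupNamespace false

namespace Summit.ABC.ABC.Cruxes.SteinbergCore.StubIdeas2G18

open Literature.NumberTheory.EllipticCurves Literature.NumberTheory.EllipticCurves.ModularForms

/-- The registered stub, verbatim. -/
def Stub : Prop :=
  ∀ ε : ℝ, 0 < ε → ∃ C : ℝ, ∀ a b : ℤ, IsCoprime a b → a * b * (a + b) ≠ 0 → ∀ (N : ℕ) [NeZero N], (Literature.NumberTheory.EllipticCurves.freyCurve a b).conductorNorm ℤ = N → ∀ D : Literature.NumberTheory.EllipticCurves.ModularForms.ModularParametrizationData (Literature.NumberTheory.EllipticCurves.freyCurve a b) N, (∀ D' : Literature.NumberTheory.EllipticCurves.ModularForms.ModularParametrizationData (Literature.NumberTheory.EllipticCurves.freyCurve a b) N, D.deg ≤ D'.deg) → ((D.deg / (ordProj[2] D.deg * ordProj[3] D.deg) : ℕ) : ℝ) ≤ C * (N : ℝ) ^ (2 + ε)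

/-- Prime-to-`S` part of `n` (`S` a finite set of primes): `n / ∏_{p ∈ S} p^{v_p(n)}`. -/
def cpsS (S : Finset ℕ) (n : ℕ) : ℕ :=
  n / ∏ p ∈ S, ordProj[p] n

/-- (S) The `S`-credited stub: prime-to-`S` part of the minimal degree `≤ C·N^(2+ε)`. -/
def StubS (S : Finset ℕ) : Prop :=
  ∀ ε : ℝ, 0 < ε → ∃ C : ℝ, ∀ a b : ℤ, IsCoprime a b → a * b * (a + b) ≠ 0 → ∀ (N : ℕ) [NeZero N],
    (freyCurve a b).conductorNorm ℤ = N → ∀ D : ModularParametrizationData (freyCurve a b) N,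
      (∀ D' : ModularParametrizationData (freyCurve a b) N, D.deg ≤ D'.deg) →
        ((cpsS S D.deg : ℕ) : ℝ) ≤ C * (N : ℝ) ^ (2 + ε)

/-- S1: the stub is the rung `S = {2,3}` (`Finset.prod_pair`). One prover cycle. -/
theorem stub_iff_stubS_pair : Stub ↔ StubS {2, 3} := by
  simp only [Stub, StubS, cpsS, Finset.prod_pair (show (2 : ℕ) ≠ 3 by decide)]

/-- S2: monotonicity of the ladder — crediting more primes weakens the statement
(`cpsS T n ≤ cpsS S n` for `S ⊆ T`; primality not even needed). PROVED. -/
theorem stubS_mono {S T : Finset ℕ} (hST : S ⊆ T) : StubS S → StubS T := by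
  intro h ε hε
  obtain ⟨C, hC⟩ := h ε hε
  refine ⟨C, fun a b hab h0 N _ hN D hD => le_trans ?_ (hC a b hab h0 N hN D hD)⟩
  have hle : cpsS T D.deg ≤ cpsS S D.deg := by
    unfold cpsS
    apply Nat.div_le_div_left
    · exact Finset.prod_le_prod_of_subset_of_one_le' hST (fun p _ _ => Nat.ordProj_pos _ _)
    · exact Finset.prod_pos (fun p _ => Nat.ordProj_pos _ _)
  exact_mod_cast hle

/-- S3: the bottom rung `S = ∅` is the full minimal-degree bound (`cpsS ∅ n = n`), i.e. the statement
`MinimalDegreeBound` of `Theorems/DefiniteXiSteinbergCoreSplit.lean`, fed by the route target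
`DefiniteXi.FreyDegreeBound` (H0). One prover cycle. -/
theorem stubS_empty_iff :
    StubS ∅ ↔ (∀ ε : ℝ, 0 < ε → ∃ C : ℝ, ∀ a b : ℤ, IsCoprime a b → a * b * (a + b) ≠ 0 → ∀ (N : ℕ) [NeZero N],
      (freyCurve a b).conductorNorm ℤ = N → ∀ D : ModularParametrizationData (freyCurve a b) N,
        (∀ D' : ModularParametrizationData (freyCurve a b) N, D.deg ≤ D'.deg) →
          ((D.deg : ℕ) : ℝ) ≤ C * (N : ℝ) ^ (2 + ε)) := by
  simp only [StubS, cpsS, Finset.prod_empty, Nat.div_one]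

/-- (A) Strengthen-to-simplify: the prime-to-6 degree conjecture for ALL `E/ℚ` (uniform in the curve;
the natural home of the Hecke-side tools `deg ∣ r_f`, `v_p(deg) = v_p(r_f)` for `p² ∤ N`). -/
def StubAll : Prop :=
  ∀ ε : ℝ, 0 < ε → ∃ C : ℝ, ∀ (W : WeierstrassCurve ℚ) (N : ℕ) [NeZero N],
    W.conductorNorm ℤ = N → ∀ D : ModularParametrizationData W N,
      (∀ D' : ModularParametrizationData W N, D.deg ≤ D'.deg) →
        ((D.deg / (ordProj[2] D.deg * ordProj[3] D.deg) : ℕ) : ℝ) ≤ C * (N : ℝ) ^ (2 + ε)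

/-- A1: specialisation `StubAll → Stub`. -/
theorem stub_of_stubAll (h : StubAll) : Stub := by
  intro ε hε
  obtain ⟨C, hC⟩ := h ε hε
  exact ⟨C, fun a b _ _ N _ hN D hD => hC _ N hN D hD⟩

end Summit.ABC.ABC.Cruxes.SteinbergCore.StubIdeas2G18

end
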